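import Summits.ValiantsHypothesis.ValiantsHypothesis.Theorems.LacunarySymmetroidMatrixDescartesLagrangeMirrorFrame
import Summits.ValiantsHypothesis.ValiantsHypothesis.Theorems.LacunarySymmetroidMatrixDescartesKThreeColumnLawHolds

/-!
# `MatrixDescartes` census — two-sided (mirror) Lagrange tower: the mirror tower is good; the congruence of the two top levels

HONEST FRAMING.  Object-search cell `pub-symmetroid`, crux `Theses.LacunarySymmetroid.MatrixDescartes`
(stmt-ValiantsHypothesis-18050); seat val-sym-mdr-p1 (g2).  Part of the kernel port of the cell's TWO-SIDED Lagrange tower P4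
(conjb-3 g4, ROUND4-MEMO §2) in the seat's arrowhead form (`…LagrangeMirrorDefs`): for EVERY `m ≥ 1` some real symmetric FOUR-term
lacunary `m × m` pencil has `m² + 2m` distinct positive determinant roots (`¬ PosRootLawAt m 4 ((m+1)² − 2)`).  A LOWER-bound /
construction statement in census (CONJECTURE-A) currency for the `K = 4` column; it proves nothing about the crux `MatrixDescartes`
(an upper-bound statement at fat formats), nothing about the cubic-vs-quadratic fork beyond this floor, and nothing about `VP ≠ VNP`.
No definitions in this file.

THIS FILE. Windows of the mirror tower (`mroot_child_lt_parent`: parent ABOVE child), `mtower_goodAt` / `mtower_top_good`, leading blocks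
(`mtower_leading`), level determinants (`det_levelAt`), symmetry; and the CONGRUENCE between the two top levels built from the frames only:
`congC_mul_congCinv`, `congCinv_mul_congC`, `congC_conj : Cᵀ (ε (A₂ + t B₂)) C = A₁ + t B₁`, `congCinv_conj`. [folklore]
-/

-- `Summit.ValiantsHypothesis.ValiantsHypothesis.…` repeats a component by the D-0017 layout
-- (single-conjunct summit), which the `dupNamespace` linter flags; the name is mandated.
set_option linter.dupNamespace false

namespace Summit.ValiantsHypothesis.ValiantsHypothesis.Theorems.LacunarySymmetroidMatrixDescartes.Census.LagrangeTower

open Matrix Polynomial Finset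
open scoped BigOperators

section Mirror

/-! ### Windows of the mirror tower -/

/-- `zroot k i = zwin k i`. -/
theorem zroot_eq_zwin (k : ℕ) (i : Fin k) : zroot k i = zwin k i := rfl

/-- `4^{-w} < zwin w i`. -/
theorem zwin_gt (w i : ℕ) : ((4 : ℝ)⁻¹) ^ w < zwin w i := by
  unfold zwin
  have h : 0 < ((i : ℝ) + 1) / ((w : ℝ) + 1) := by positivity
  nlinarith [four_inv_pow_pos w]

/-- `zwin w i < 2·4^{-w}` for `i < w`. -/
theorem zwin_lt (w i : ℕ) (hi : i < w) : zwin w i < 2 * ((4 : ℝ)⁻¹) ^ w := by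
  unfold zwin
  have hw : 0 < (w : ℝ) + 1 := by positivity
  have hi' : (i : ℝ) + 1 ≤ w := by exact_mod_cast hi
  have : ((i : ℝ) + 1) / ((w : ℝ) + 1) < 1 := by rw [div_lt_one hw]; linarith
  nlinarith [four_inv_pow_pos w]

/-- `zwin w` increases with the index. -/
theorem zwin_lt_zwin (w : ℕ) {i j : ℕ} (h : i < j) : zwin w i < zwin w j := by
  unfold zwin
  have hw : 0 < (w : ℝ) + 1 := by positivity
  have h' : (i : ℝ) + 1 ≤ j := by exact_mod_cast h
  apply mul_lt_mul_of_pos_left _ (four_inv_pow_pos w)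
  have : ((i : ℝ) + 1) / ((w : ℝ) + 1) < ((j : ℝ) + 1) / ((w : ℝ) + 1) := div_lt_div_of_pos_right (by linarith) hw
  linarith

/-- The mirror root vector is increasing. -/
theorem mroot_strictMono (m k : ℕ) : StrictMono (mroot m k) := fun i j h => zwin_lt_zwin _ (by exact_mod_cast h)

/-- The mirror roots are `< 5`. -/
theorem mroot_lt_five (m k : ℕ) (hk : k ≤ m) (i : Fin k) : mroot m k i < 5 := by
  unfold mroot
  have h1 := zwin_lt (2 * m - k) i (by have := i.isLt; omega)
  have : ((4 : ℝ)⁻¹) ^ (2 * m - k) ≤ 1 := pow_le_one₀ (by norm_num) (by norm_num)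
  linarith

/-- **Mirror separation**: the parent level `k+1` (window `2m − k − 1`) lies ABOVE the child level `k` (window `2m − k`), for `k + 1 ≤ m`. -/
theorem mroot_child_lt_parent (m k : ℕ) (hk : k + 1 ≤ m) (i : Fin (k + 1)) (l : Fin k) :
    mroot m k l < mroot m (k + 1) i := by
  unfold mroot
  have h1 := zwin_lt (2 * m - k) l (by have := l.isLt; omega)
  have h2 := zwin_gt (2 * m - (k + 1)) i
  have h3 : 2 * ((4 : ℝ)⁻¹) ^ (2 * m - k) ≤ ((4 : ℝ)⁻¹) ^ (2 * m - (k + 1)) := by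
    rw [show 2 * m - k = (2 * m - (k + 1)) + 1 by omega, pow_succ]
    nlinarith [four_inv_pow_pos (2 * m - (k + 1))]
  linarith

/-- The top mirror level has the same roots as `tower m`. -/
theorem mroot_top (m : ℕ) : mroot m m = zroot m := by
  funext i
  unfold mroot zroot zwin
  rw [show 2 * m - m = m by omega]

/-! ### The mirror tower is good -/

/-- `Good` is `GoodAt` the standard roots. -/
theorem good_iff_goodAt {k : ℕ} (d : TowerData k) : d.Good ↔ d.GoodAt (zroot k) := Iff.rfl

/-- The empty level is good for the (empty) mirror roots. -/
theorem towerZero_goodAt (ρ : Fin 0 → ℝ) : towerZero.GoodAt ρ := by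
  refine ⟨Or.inl rfl, by simp [towerZero], fun x => ?_, fun i => i.elim0⟩
  ext i j; exact i.elim0

/-- **Every mirror level `k ≤ m` is good** (split frame with roots `mroot m k`, alternating characteristic). -/
theorem mtower_goodAt (m : ℕ) : ∀ k : ℕ, k ≤ m → (mtower m k).GoodAt (mroot m k)
  | 0, _ => towerZero_goodAt _
  | k + 1, hk => by
    have ih := mtower_goodAt m k (by omega)
    show (Gen.step (mroot m k) (mroot m (k + 1)) (-1) (mtower m k)).GoodAt (mroot m (k + 1))
    exact Gen.step_good _ _ _ _ ih (mroot_strictMono m k) (mroot_strictMono m (k + 1))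
      (mroot_lt_five m k (by omega)) (Or.inr ⟨rfl, fun i l => mroot_child_lt_parent m k hk i l⟩)

/-- The top mirror level is good for the standard roots `zroot m`. -/
theorem mtower_top_good (m : ℕ) : (mtower m m).Good := by
  rw [good_iff_goodAt, ← mroot_top]
  exact mtower_goodAt m m le_rfl

/-! ### Leading blocks and determinants of the mirror levels -/

/-- Leading block of the general step's constant letter. -/
theorem Gen.step_A_castSucc {k : ℕ} (ν : Fin k → ℝ) (z : Fin (k + 1) → ℝ) (s : ℝ) (d : TowerData k) (a b : Fin k) :
    (Gen.step ν z s d).A (Fin.castSucc a) (Fin.castSucc b) = d.A a b := by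
  simp [Gen.step, Matrix.reindex_apply]

/-- Leading block of the general step's linear letter. -/
theorem Gen.step_B_castSucc {k : ℕ} (ν : Fin k → ℝ) (z : Fin (k + 1) → ℝ) (s : ℝ) (d : TowerData k) (a b : Fin k) :
    (Gen.step ν z s d).B (Fin.castSucc a) (Fin.castSucc b) = d.B a b := by
  simp [Gen.step, Matrix.reindex_apply]

/-- **Leading blocks of the mirror tower are its lower levels.** -/
theorem mtower_leading (m : ℕ) : ∀ (k j : ℕ) (h : j ≤ k),
    ((mtower m k).A).submatrix (Fin.castLE h) (Fin.castLE h) = (mtower m j).A ∧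
      ((mtower m k).B).submatrix (Fin.castLE h) (Fin.castLE h) = (mtower m j).B
  | 0, j, h => by
    obtain rfl : j = 0 := Nat.le_zero.mp h
    constructor <;> (ext a b; exact a.elim0)
  | k + 1, j, h => by
    rcases Nat.lt_or_ge j (k + 1) with hlt | hge
    · have h' : j ≤ k := Nat.lt_succ_iff.mp hlt
      obtain ⟨ihA, ihB⟩ := mtower_leading m k j h'
      constructor
      · rw [← ihA]
        ext a b
        simp only [Matrix.submatrix_apply, castLE_eq_castSucc_castLE h h']
        exact Gen.step_A_castSucc _ _ _ (mtower m k) _ _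
      · rw [← ihB]
        ext a b
        simp only [Matrix.submatrix_apply, castLE_eq_castSucc_castLE h h']
        exact Gen.step_B_castSucc _ _ _ (mtower m k) _ _
    · obtain rfl : j = k + 1 := le_antisymm h hge
      constructor <;>
      · ext a b
        rfl

/-- `det W ≠ 0` on a `GoodAt` level. -/
theorem det_W_ne_zero_of_goodAt {j : ℕ} {ρ : Fin j → ℝ} (d : TowerData j) (hd : d.GoodAt ρ) : d.W.det ≠ 0 := by
  intro h
  have h1 := congrArg Matrix.det hd.2.1
  rw [Matrix.det_mul, Matrix.det_transpose, h, zero_mul, Matrix.det_one] at h1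
  exact zero_ne_one h1

/-- **Determinant of a `GoodAt` level**: `det(W)² · det(A + tB) = ∏_i β_i (t − ρ_i)`. -/
theorem det_levelAt {j : ℕ} {ρ : Fin j → ℝ} (d : TowerData j) (hd : d.GoodAt ρ) (t : ℝ) :
    d.W.det ^ 2 * Matrix.det (d.A + t • d.B) = ∏ i, d.β i * (t - ρ i) := by
  have h := congrArg Matrix.det (hd.2.2.1 t)
  rw [Matrix.det_mul, Matrix.det_mul, Matrix.det_transpose, Matrix.det_diagonal] at h
  rw [← h]; ring

/-- A `GoodAt` level's determinant does not vanish off its designed roots. -/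
theorem det_levelAt_ne_zero {j : ℕ} {ρ : Fin j → ℝ} (d : TowerData j) (hd : d.GoodAt ρ) (t : ℝ)
    (ht : ∀ i, t ≠ ρ i) : Matrix.det (d.A + t • d.B) ≠ 0 := by
  have hprod : ∏ i, d.β i * (t - ρ i) ≠ 0 := by
    refine Finset.prod_ne_zero_iff.mpr fun i _ => mul_ne_zero ?_ (sub_ne_zero.mpr (ht i))
    intro h0; have := hd.2.2.2 i; rw [h0, mul_zero] at this; exact lt_irrefl _ this
  intro h0
  have := det_levelAt d hd t
  rw [h0, mul_zero] at this
  exact hprod this.symm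

/-- Both letters of a `GoodAt` level are symmetric. -/
theorem levelAt_symm {k : ℕ} {ρ : Fin k → ℝ} (d : TowerData k) (hd : d.GoodAt ρ) : d.A.IsSymm ∧ d.B.IsSymm := by
  have hWU : d.Wᵀ * d.U = 1 := hd.2.1
  have hUW : d.U * d.Wᵀ = 1 := mul_eq_one_comm.mp hWU
  have hWUt : d.W * d.Uᵀ = 1 := by
    have := congrArg Matrix.transpose hUW
    rwa [Matrix.transpose_mul, Matrix.transpose_transpose, Matrix.transpose_one] at this
  have key : ∀ (M D : Matrix (Fin k) (Fin k) ℝ), d.Wᵀ * M * d.W = D → Dᵀ = D → M.IsSymm := by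
    intro M D h hD
    have hM : M = d.U * D * d.Uᵀ := by
      calc M = (d.U * d.Wᵀ) * M * (d.W * d.Uᵀ) := by rw [hUW, hWUt, Matrix.one_mul, Matrix.mul_one]
        _ = d.U * (d.Wᵀ * M * d.W) * d.Uᵀ := by simp only [Matrix.mul_assoc]
        _ = d.U * D * d.Uᵀ := by rw [h]
    unfold Matrix.IsSymm
    rw [hM, Matrix.transpose_mul, Matrix.transpose_mul, Matrix.transpose_transpose, hD, Matrix.mul_assoc]
  exact ⟨key _ _ (Gen.W_A_W ρ d hd) (Matrix.diagonal_transpose _), key _ _ (Gen.W_B_W ρ d hd) (Matrix.diagonal_transpose _)⟩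

/-- `A + tB = U · diagonal(β (t − ρ)) · Uᵀ` on a `GoodAt` level. -/
theorem levelAt_pencil_eq {k : ℕ} {ρ : Fin k → ℝ} (d : TowerData k) (hd : d.GoodAt ρ) (t : ℝ) :
    d.A + t • d.B = d.U * diagonal (fun i => d.β i * (t - ρ i)) * d.Uᵀ := by
  have hWU : d.Wᵀ * d.U = 1 := hd.2.1
  have hUW : d.U * d.Wᵀ = 1 := mul_eq_one_comm.mp hWU
  have hWUt : d.W * d.Uᵀ = 1 := by
    have := congrArg Matrix.transpose hUW
    rwa [Matrix.transpose_mul, Matrix.transpose_transpose, Matrix.transpose_one] at this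
  calc d.A + t • d.B = (d.U * d.Wᵀ) * (d.A + t • d.B) * (d.W * d.Uᵀ) := by
        rw [hUW, hWUt, Matrix.one_mul, Matrix.mul_one]
    _ = d.U * (d.Wᵀ * (d.A + t • d.B) * d.W) * d.Uᵀ := by simp only [Matrix.mul_assoc]
    _ = d.U * diagonal (fun i => d.β i * (t - ρ i)) * d.Uᵀ := by rw [hd.2.2.1 t]

end Mirror

section Congruence

variable (m : ℕ)

/-- `ε = ±1`. -/
theorem congEps_cases : congEps m = 1 ∨ congEps m = -1 := by
  unfold congEps
  rcases (tower_good m).1 with h1 | h1 <;> rcases (mtower_top_good m).1 with h2 | h2 <;> norm_num [h1, h2]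

/-- `ε² = 1`. -/
theorem congEps_sq : congEps m * congEps m = 1 := by
  rcases congEps_cases m with h | h <;> rw [h] <;> norm_num

/-- `0 < ε β₁_i / β₂_i`: the two top levels have sign characteristics of the same pattern up to `ε`. -/
theorem congRatio_pos (i : Fin m) : 0 < congEps m * (tower m).β i / (mtower m m).β i := by
  have h1 := (tower_good m).2.2.2 i
  have h2 := (mtower_top_good m).2.2.2 i
  have hsq : ((-1 : ℝ) ^ (i : ℕ)) * (-1) ^ (i : ℕ) = 1 := by rw [← pow_add, ← two_mul, pow_mul]; norm_num
  have hQ : 0 < (tower m).θ * (mtower m m).θ * (tower m).β i * (mtower m m).β i := by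
    have := mul_pos h1 h2
    rw [show (tower m).θ * (-1) ^ (i : ℕ) * (tower m).β i * ((mtower m m).θ * (-1) ^ (i : ℕ) * (mtower m m).β i)
        = ((-1 : ℝ) ^ (i : ℕ) * (-1) ^ (i : ℕ)) * ((tower m).θ * (mtower m m).θ * (tower m).β i * (mtower m m).β i)
        by ring, hsq, one_mul] at this
    exact this
  unfold congEps
  apply div_pos_iff.mpr
  rcases mul_pos_iff.mp hQ with ⟨ha, hb⟩ | ⟨ha, hb⟩
  · exact Or.inl ⟨ha, hb⟩
  · exact Or.inr ⟨ha, hb⟩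

/-- The entries of `S` are positive. -/
theorem congS_entry_pos (i : Fin m) : 0 < Real.sqrt (congEps m * (tower m).β i / (mtower m m).β i) :=
  Real.sqrt_pos.mpr (congRatio_pos m i)

/-- `S · S⁻¹ = 1`. -/
theorem congS_mul_congSinv : congS m * congSinv m = 1 := by
  unfold congS congSinv
  rw [Matrix.diagonal_mul_diagonal, ← Matrix.diagonal_one]
  congr 1; funext i
  exact mul_inv_cancel₀ (congS_entry_pos m i).ne'

/-- `S⁻¹ · S = 1`. -/
theorem congSinv_mul_congS : congSinv m * congS m = 1 := by
  unfold congS congSinv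
  rw [Matrix.diagonal_mul_diagonal, ← Matrix.diagonal_one]
  congr 1; funext i
  exact inv_mul_cancel₀ (congS_entry_pos m i).ne'

/-- `W Uᵀ = 1` on a good level (`Wᵀ U = 1` and finiteness). -/
theorem W_mul_U_transpose {k : ℕ} {ρ : Fin k → ℝ} (d : TowerData k) (hd : d.GoodAt ρ) : d.W * d.Uᵀ = 1 := by
  have hUW : d.U * d.Wᵀ = 1 := mul_eq_one_comm.mp hd.2.1
  have := congrArg Matrix.transpose hUW
  rwa [Matrix.transpose_mul, Matrix.transpose_transpose, Matrix.transpose_one] at this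

/-- `Uᵀ W = 1` on a good level. -/
theorem U_transpose_mul_W {k : ℕ} {ρ : Fin k → ℝ} (d : TowerData k) (hd : d.GoodAt ρ) : d.Uᵀ * d.W = 1 := by
  have := congrArg Matrix.transpose hd.2.1
  rwa [Matrix.transpose_mul, Matrix.transpose_transpose, Matrix.transpose_one] at this

/-- `C · C⁻¹ = 1`. -/
theorem congC_mul_congCinv : congC m * congCinv m = 1 := by
  unfold congC congCinv
  have h1 : ((tower m).U)ᵀ * (tower m).W = 1 := U_transpose_mul_W (tower m) (tower_good m)
  have h2 : (mtower m m).W * ((mtower m m).U)ᵀ = 1 := W_mul_U_transpose (mtower m m) (mtower_top_good m)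
  calc (mtower m m).W * congS m * ((tower m).U)ᵀ * ((tower m).W * congSinv m * ((mtower m m).U)ᵀ)
      = (mtower m m).W * (congS m * (((tower m).U)ᵀ * (tower m).W) * congSinv m) * ((mtower m m).U)ᵀ := by
        simp only [Matrix.mul_assoc]
    _ = 1 := by rw [h1, Matrix.mul_one, congS_mul_congSinv, Matrix.mul_one, h2]

/-- `C⁻¹ · C = 1`. -/
theorem congCinv_mul_congC : congCinv m * congC m = 1 := by
  unfold congC congCinv
  have h1 : ((mtower m m).U)ᵀ * (mtower m m).W = 1 := U_transpose_mul_W (mtower m m) (mtower_top_good m)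
  have h2 : (tower m).W * ((tower m).U)ᵀ = 1 := W_mul_U_transpose (tower m) (tower_good m)
  calc (tower m).W * congSinv m * ((mtower m m).U)ᵀ * ((mtower m m).W * congS m * ((tower m).U)ᵀ)
      = (tower m).W * (congSinv m * (((mtower m m).U)ᵀ * (mtower m m).W) * congS m) * ((tower m).U)ᵀ := by
        simp only [Matrix.mul_assoc]
    _ = 1 := by rw [h1, Matrix.mul_one, congSinv_mul_congS, Matrix.mul_one, h2]

/-- `det C⁻¹ ≠ 0`. -/
theorem det_congCinv_ne_zero : (congCinv m).det ≠ 0 := by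
  intro h
  have := congrArg Matrix.det (congCinv_mul_congC m)
  rw [Matrix.det_mul, h, zero_mul, Matrix.det_one] at this
  exact zero_ne_one this

/-- **The congruence**: `Cᵀ (ε (A₂ + t B₂)) C = A₁ + t B₁` — the two top levels are the same pencil in different frames. -/
theorem congC_conj (t : ℝ) :
    (congC m)ᵀ * (congEps m • ((mtower m m).A + t • (mtower m m).B)) * congC m = (tower m).A + t • (tower m).B := by
  have h2 := (mtower_top_good m).2.2.1 t
  have h1 := levelAt_pencil_eq (tower m) ((good_iff_goodAt _).mp (tower_good m)) t
  unfold congC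
  rw [Matrix.transpose_mul, Matrix.transpose_mul, Matrix.transpose_transpose]
  have hS : (congS m)ᵀ = congS m := Matrix.diagonal_transpose _
  rw [hS]
  calc (tower m).U * (congS m * ((mtower m m).W)ᵀ) * (congEps m • ((mtower m m).A + t • (mtower m m).B)) *
        ((mtower m m).W * congS m * ((tower m).U)ᵀ)
      = (tower m).U * (congS m * (congEps m • (((mtower m m).W)ᵀ * ((mtower m m).A + t • (mtower m m).B) *
          (mtower m m).W)) * congS m) * ((tower m).U)ᵀ := by
        simp only [Matrix.mul_assoc, Matrix.mul_smul, Matrix.smul_mul]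
    _ = (tower m).U * (congS m * (congEps m • diagonal (fun i => (mtower m m).β i * (t - zroot m i))) * congS m) *
          ((tower m).U)ᵀ := by rw [h2]
    _ = (tower m).U * diagonal (fun i => (tower m).β i * (t - zroot m i)) * ((tower m).U)ᵀ := by
        congr 2
        unfold congS
        rw [← Matrix.diagonal_smul, Matrix.diagonal_mul_diagonal, Matrix.diagonal_mul_diagonal]
        congr 1; funext i
        simp only [Pi.smul_apply, smul_eq_mul]
        have hr := congRatio_pos m i
        have hsq := Real.mul_self_sqrt hr.le
        have hβ2 : (mtower m m).β i ≠ 0 := by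
          intro h0; have := (mtower_top_good m).2.2.2 i; rw [h0, mul_zero] at this; exact lt_irrefl _ this
        have hεε := congEps_sq m
        -- √r · (ε β₂ (t−z)) · √r = r ε β₂ (t − z) = ε² β₁ (t−z)
        calc Real.sqrt (congEps m * (tower m).β i / (mtower m m).β i) *
              (congEps m * ((mtower m m).β i * (t - zroot m i))) *
              Real.sqrt (congEps m * (tower m).β i / (mtower m m).β i)
            = (Real.sqrt (congEps m * (tower m).β i / (mtower m m).β i) *
                Real.sqrt (congEps m * (tower m).β i / (mtower m m).β i)) *
              (congEps m * ((mtower m m).β i * (t - zroot m i))) := by ring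
          _ = congEps m * (tower m).β i / (mtower m m).β i * (congEps m * ((mtower m m).β i * (t - zroot m i))) := by
              rw [hsq]
          _ = (tower m).β i * (t - zroot m i) := by
              rw [show congEps m * (tower m).β i / (mtower m m).β i * (congEps m * ((mtower m m).β i * (t - zroot m i)))
                  = (congEps m * congEps m) * ((tower m).β i * (t - zroot m i)) * ((mtower m m).β i / (mtower m m).β i)
                  by ring, hεε, div_self hβ2]
              ring
    _ = (tower m).A + t • (tower m).B := h1.symm

/-- The same congruence read in the mirror frame: `C⁻ᵀ (A₁ + t B₁) C⁻¹ = ε (A₂ + t B₂)`. -/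
theorem congCinv_conj (t : ℝ) :
    (congCinv m)ᵀ * ((tower m).A + t • (tower m).B) * congCinv m = congEps m • ((mtower m m).A + t • (mtower m m).B) := by
  rw [← congC_conj m t]
  have h := congC_mul_congCinv m
  have ht : (congCinv m)ᵀ * (congC m)ᵀ = 1 := by
    rw [← Matrix.transpose_mul, h, Matrix.transpose_one]
  calc (congCinv m)ᵀ * ((congC m)ᵀ * (congEps m • ((mtower m m).A + t • (mtower m m).B)) * congC m) * congCinv m
      = ((congCinv m)ᵀ * (congC m)ᵀ) * (congEps m • ((mtower m m).A + t • (mtower m m).B)) * (congC m * congCinv m) := by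
        simp only [Matrix.mul_assoc]
    _ = congEps m • ((mtower m m).A + t • (mtower m m).B) := by rw [ht, h, Matrix.one_mul, Matrix.mul_one]

end Congruence

end Summit.ValiantsHypothesis.ValiantsHypothesis.Theorems.LacunarySymmetroidMatrixDescartes.Census.LagrangeTower
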